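import Summits.AtomisticToContinuum.BoseEinsteinCondensation.Theorems.BECInsertionCorrectorStaticResponseBoundTruncationCompactness
import Summits.AtomisticToContinuum.BoseEinsteinCondensation.Theorems.BECConjugateDominationHardCoreExtensionBoundedPositiveMinimiser
import Summits.AtomisticToContinuum.BoseEinsteinCondensation.Theorems.BECGroundStateSOSPeriodicIRBoundWFPotCross
import Literature.MathematicalPhysics.QuantumManyBody.PeriodicGroundStateNondegenerateProofs
import Literature.MathematicalPhysics.QuantumManyBody.PeriodicMaxFormBound
import Literature.MathematicalPhysics.QuantumManyBody.PeriodicKineticBudget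
import Summits.AtomisticToContinuum.BoseEinsteinCondensation.Theorems.BECThomsonPrincipleDensityResponseDefs
import HarnessLib

/-!
# Crux `PeriodicIRBound` (stmt-AtomisticToContinuum-3972), line `linear-ph-floor-wagner`, stub S-B
# `stub_fkPositiveOfMinimiser` — part 1: the operator norm of the torus Feynman–Kac semigroup of an
# INTEGRABLE (possibly unbounded) pair potential, `‖e^{-tH_v}‖ ≤ e^{-tE₀(v)}`

Helper file of the line lead (seat c2) for the registered stub S-B of the crux skeleton
`Cruxes/PeriodicIRBound/Lines/linear_ph_floor_wagner.lean` (v11): the Perron–Frobenius KEY lemma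
(nonnegative maximal-form minimisers are a.e. strictly positive) for finite-range integrable `v`, proved
through the torus Feynman–Kac semigroup `T_t = pfkL2 v L t` WITHOUT any operator theory for the unbounded
potential. This part bounds the operator norm:

* `periodicPathAction_mono_potential`, `periodicFKWeight_anti_potential`, `periodicFKSemigroup_anti_potential`,
  `pfkReal_abs_le_of_le` — the Feynman–Kac weights decrease as the potential increases, so
  `|e^{-tH_w} f| ≤ e^{-tH_v} |f|` pointwise for `v ≤ w`;
* `opNorm_pfkL2_anti_potential` — hence `‖e^{-tH_w}‖ ≤ ‖e^{-tH_v}‖` on `L²(cell)`;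
* `opNorm_pfkL2_truncPotential` — for the BOUNDED truncations `v ∧ n` of a finite-range profile the norm is
  `e^{-tE₀(v ∧ n)}` (the tree's Perron–Frobenius package: `PeriodicGroundStateFeynmanKac_holds`,
  `IsPeriodicGroundStateFK.opNorm_pfkL2`);
* `iSup_periodicGroundStateEnergy_truncPotential` — `E₀(v ∧ n) ↑ E₀(v)` at fixed `(N, L)` for integrable `v`
  (monotone convergence of forms: the compactness half `exists_limitProfile` of the sibling crux
  `StaticResponseBound` and Simon's maximal-form bound `periodicGroundStateEnergy_le_maxForm`);
* `opNorm_pfkL2_le_exp` — **`‖e^{-tH_v}‖ ≤ e^{-tE₀(v)}`** for every finite-range integrable `v`, `N ≥ 1`.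

References: Reed–Simon IV §XIII.12 (Thm XIII.44) and Thm XIII.64; B. Simon, J. Funct. Anal. 28 (1978)
377 (monotone convergence of forms); Chung–Zhao (1995) Thm 3.10.
-/

noncomputable section

open scoped BigOperators ENNReal NNReal InnerProductSpace Topology
open Filter MeasureTheory UnitAddTorus

namespace Summit.AtomisticToContinuum.BoseEinsteinCondensation.Cruxes.PeriodicIRBound.LinearPhFloorWagner

open Literature.MathematicalPhysics.QuantumManyBody
open Literature.MathematicalPhysics.QuantumManyBody.BoseGas
open Summit.AtomisticToContinuum.BoseEinsteinCondensation.Cruxes.StaticResponseBound.UvThomsonForceWave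
  (exists_limitProfile periodicGroundStateEnergy_truncPotential_le' monotone_periodicGroundStateEnergy_truncPotential)
open Summit.AtomisticToContinuum.BoseEinsteinCondensation.Cruxes.HardCoreExtension.ThirdLawCurrentFloor
  (exists_periodizedPotential_le)

open Summit.AtomisticToContinuum.BoseEinsteinCondensation.Cruxes.DensityResponse.ForceBalanceConstitutive
  (isRepulsiveFiniteRange_truncPotential)

variable {N : ℕ}

/-! ## §1 Monotonicity of the Feynman–Kac weights in the potential -/

/-- The periodised action increases with the potential profile. [folklore] -/
theorem periodicPathAction_mono_potential {v w : ℝ → ℝ≥0∞} (h : ∀ r, v r ≤ w r) (L t : ℝ)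
    (X : Config N) (ω : PathSpace N) : periodicPathAction v L t X ω ≤ periodicPathAction w L t X ω :=
  lintegral_mono fun _ => periodicInteraction_mono_of_le h L _

/-- The Feynman–Kac weight decreases as the potential profile increases. [folklore] -/
theorem periodicFKWeight_anti_potential {v w : ℝ → ℝ≥0∞} (h : ∀ r, v r ≤ w r) (L t : ℝ)
    (X : Config N) (ω : PathSpace N) : periodicFKWeight w L t X ω ≤ periodicFKWeight v L t X ω :=
  expNeg_antitone (periodicPathAction_mono_potential h L t X ω)

/-- The `[0, ∞]`-valued Feynman–Kac functional decreases as the potential profile increases. [folklore] -/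
theorem periodicFKSemigroup_anti_potential {v w : ℝ → ℝ≥0∞} (h : ∀ r, v r ≤ w r) (L t : ℝ)
    (g : Config N → ℝ≥0∞) (X : Config N) : periodicFKSemigroup w L t g X ≤ periodicFKSemigroup v L t g X :=
  lintegral_mono fun ω => mul_le_mul' (periodicFKWeight_anti_potential h L t X ω) le_rfl

/-- **`|e^{-tH_w} f| ≤ e^{-tH_v} |f|` pointwise for `v ≤ w`** (periodic measurable `f ∈ L²(cell)`, `t, L > 0`):
domination of the semigroup of the larger potential by that of the smaller one. [folklore] -/
theorem pfkReal_abs_le_of_le {v w : ℝ → ℝ≥0∞} (hv : Measurable v) (hw : Measurable w) (h : ∀ r, v r ≤ w r)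
    {L : ℝ} (hL : 0 < L) {t : ℝ} (ht : 0 < t) {f : Config N → ℝ} (hf : Measurable f)
    (hper : ∀ (Y : Config N) (i : Fin N) (k : Fin 3), f (Y + Pi.single i (EuclideanSpace.single k L)) = f Y)
    (hf2 : ∫⁻ Y in cellN N L, ‖f Y‖ₑ ^ (2 : ℝ) ≠ ⊤) (X : Config N) :
    |pfkReal w L t f X| ≤ pfkReal v L t (fun Y => |f Y|) X := by
  refine (abs_pfkReal_le w L t f X).trans ?_
  have hmabs : Measurable fun Y => |f Y| := continuous_abs.measurable.comp hf
  have h0 : ∀ Y, 0 ≤ |f Y| := fun Y => abs_nonneg _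
  rw [pfkReal_eq_toReal_periodicFKSemigroup hw L t hmabs h0 X,
    pfkReal_eq_toReal_periodicFKSemigroup hv L t hmabs h0 X]
  have hG : Measurable fun Y => ENNReal.ofReal |f Y| := hmabs.ennreal_ofReal
  have hGper : ∀ (Y : Config N) (i : Fin N) (k : Fin 3),
      ENNReal.ofReal |f (Y + Pi.single i (EuclideanSpace.single k L))| = ENNReal.ofReal |f Y| := by
    intro Y i k; rw [hper]
  have hG2 : ∫⁻ Y in cellN N L, ENNReal.ofReal |f Y| ^ (2 : ℝ) ≠ ⊤ := by
    simpa only [Real.enorm_eq_ofReal_abs] using hf2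
  have hfin := periodicFKSemigroup_lt_top_of_cell v hL ht hG hGper hG2 X
  exact ENNReal.toReal_mono hfin.ne (periodicFKSemigroup_anti_potential h L t _ X)

/-- **`‖e^{-tH_w}‖ ≤ ‖e^{-tH_v}‖` on `L²(cell)` for `v ≤ w`** (`t, L > 0`): `‖e^{-tH_w} g‖ ≤ ‖e^{-tH_v}|g|‖ ≤ ‖e^{-tH_v}‖‖g‖`.
[folklore] -/
theorem opNorm_pfkL2_anti_potential {v w : ℝ → ℝ≥0∞} (hv : Measurable v) (hw : Measurable w)
    (h : ∀ r, v r ≤ w r) {L : ℝ} (hL : 0 < L) {t : ℝ} (ht : 0 < t) :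
    ‖(pfkL2 w L t : Lp ℝ 2 (volume.restrict (cellN N L)) →L[ℝ] Lp ℝ 2 (volume.restrict (cellN N L)))‖ ≤
      ‖(pfkL2 v L t : Lp ℝ 2 (volume.restrict (cellN N L)) →L[ℝ] Lp ℝ 2 (volume.restrict (cellN N L)))‖ := by
  refine ContinuousLinearMap.opNorm_le_bound _ (norm_nonneg _) fun g => ?_
  have hgm : Measurable ((g : Config N → ℝ) ∘ cellProj L) :=
    (measurable_coeFn_Lp_cellN g).comp (measurable_cellProj L)
  have hgper := comp_cellProj_periodic hL.ne' (g : Config N → ℝ)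
  have hg2 := setLIntegral_cellN_enorm_comp_cellProj_sq_ne_top hL g
  have h1 : ‖pfkL2 w L t g‖ ≤ ‖pfkL2 v L t |g|‖ := by
    refine Lp.norm_le_norm_of_ae_le ?_
    filter_upwards [pfkL2_coeFn hw hL ht g, pfkL2_coeFn hv hL ht |g|] with X h1 h2
    rw [h1, h2, Real.norm_eq_abs, Real.norm_eq_abs,
      pfkReal_comp_cellProj_congr_ae v hL ht (Lp.coeFn_abs g) X]
    refine (pfkReal_abs_le_of_le hv hw h hL ht hgm hgper hg2 X).trans (le_of_eq ?_)
    have hnn : 0 ≤ pfkReal v L t ((fun x => |(g : Config N → ℝ) x|) ∘ cellProj L) X :=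
      pfkReal_nonneg v L t (fun Y => abs_nonneg _) X
    rw [abs_of_nonneg hnn]
    rfl
  calc ‖pfkL2 w L t g‖ ≤ ‖pfkL2 v L t |g|‖ := h1
    _ ≤ ‖(pfkL2 v L t : Lp ℝ 2 (volume.restrict (cellN N L)) →L[ℝ] _)‖ * ‖|g|‖ :=
        ContinuousLinearMap.le_opNorm _ _
    _ = _ := by rw [norm_abs_eq_norm]

/-! ## §2 The bounded truncations and the truncation limit -/

/-- **`‖e^{-tH_{v∧n}}‖ = e^{-tE₀(v ∧ n)}`** for the BOUNDED truncations of a finite-range profile (`N ≥ 1`,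
`t, L > 0`): the tree's Perron–Frobenius package (`PeriodicGroundStateFeynmanKac_holds`,
`IsPeriodicGroundStateFK.opNorm_pfkL2`). [cite: ReedSimonIV1978, Thm XIII.44] -/
theorem opNorm_pfkL2_truncPotential {v : ℝ → ℝ≥0∞} (hv : IsRepulsiveFiniteRange v) (hN : 1 ≤ N) {L : ℝ}
    (hL : 0 < L) (n : ℕ) {t : ℝ} (ht : 0 < t) :
    ‖(pfkL2 (truncPotential v n) L t : Lp ℝ 2 (volume.restrict (cellN N L)) →L[ℝ] _)‖ =
      Real.exp (-((periodicGroundStateEnergy (truncPotential v n) N L).toReal * t)) := by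
  have hvn := isRepulsiveFiniteRange_truncPotential hv n
  have hM : ∃ M : ℝ≥0∞, M ≠ ⊤ ∧ ∀ r, truncPotential v n r ≤ M :=
    ⟨n, ENNReal.natCast_ne_top n, fun r => min_le_right _ _⟩
  obtain ⟨C, hC⟩ := exists_periodizedPotential_le hvn hM hL
  obtain ⟨Ψ₀, hΨ₀, -, -⟩ := PeriodicGroundStateFeynmanKac_holds N L (truncPotential v n) hN hL hvn.1 ⟨C, hC⟩
  exact (hΨ₀.opNorm_pfkL2 hvn.1 hL hC ht).1

/-- The variational ground-state energy of an integrable interaction is finite (`N ≥ 1`, `L > 0`).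
[cite: ReedSimonIV1978, Thm XIII.64] -/
theorem periodicGroundStateEnergy_ne_top_of_integrable {v : ℝ → ℝ≥0∞} (hv : Measurable v) (hN : 1 ≤ N)
    {L : ℝ} (hL : 0 < L) (hW : ∫⁻ X in cellN N L, periodicInteraction v L X ≠ ⊤) :
    periodicGroundStateEnergy v N L ≠ ⊤ := by
  obtain ⟨E₁, _, -, -, hE, -⟩ := exists_two_lowest_eigenvalues hL hv hW hN
  rw [hE]
  exact ENNReal.ofReal_ne_top

/-- **Monotone convergence of the truncated ground-state energies at fixed `(N, L)`**:
`⨆ₙ E₀(v ∧ n) = E₀(v)` for a measurable profile with INTEGRABLE interaction — the compactness half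
`exists_limitProfile` (Rellich + Fatou + Beppo Levi) and Simon's maximal-form bound
`periodicGroundStateEnergy_le_maxForm`. [cite: ReedSimonIV1978, Thm XIII.64] -/
theorem iSup_periodicGroundStateEnergy_truncPotential {v : ℝ → ℝ≥0∞} (hv : Measurable v) (hN : 1 ≤ N)
    {L : ℝ} (hL : 0 < L) (hW : ∫⁻ X in cellN N L, periodicInteraction v L X ≠ ⊤) :
    ⨆ n : ℕ, periodicGroundStateEnergy (truncPotential v n) N L = periodicGroundStateEnergy v N L := by
  refine le_antisymm (iSup_le fun n => periodicGroundStateEnergy_truncPotential_le' v n N L) ?_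
  have hfin := periodicGroundStateEnergy_ne_top_of_integrable hv hN hL hW
  have hsup : (⨆ n : ℕ, periodicGroundStateEnergy (truncPotential v n) N L) ≠ ⊤ :=
    ne_top_of_le_ne_top hfin (iSup_le fun n => periodicGroundStateEnergy_truncPotential_le' v n N L)
  obtain ⟨η, hη1, hsymm, hQ⟩ := exists_limitProfile hv hL hsup
  exact (periodicGroundStateEnergy_le_maxForm hL hv hW η hη1 hsymm).trans hQ

/-- **`‖e^{-tH_v}‖ ≤ e^{-tE₀(v)}` on `L²(cell)` for every finite-range INTEGRABLE profile** (`N ≥ 1`,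
`t, L > 0`; `v^per` possibly unbounded): domination by the truncations, their Perron–Frobenius norms, and the
truncation limit. No spectral theory of the unbounded `H_v` is used. [cite: ReedSimonIV1978, Thm XIII.44] -/
theorem opNorm_pfkL2_le_exp {v : ℝ → ℝ≥0∞} (hv : IsRepulsiveFiniteRange v) (hint : (∫⁻ x : Space, v ‖x‖) ≠ ⊤)
    (hN : 1 ≤ N) {L : ℝ} (hL : 0 < L) {t : ℝ} (ht : 0 < t) :
    ‖(pfkL2 v L t : Lp ℝ 2 (volume.restrict (cellN N L)) →L[ℝ] _)‖ ≤
      Real.exp (-((periodicGroundStateEnergy v N L).toReal * t)) := by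
  have hW := WF.lintegral_cellN_periodicInteraction_ne_top hL hv.1 hint N
  set E : ℕ → ℝ≥0∞ := fun n => periodicGroundStateEnergy (truncPotential v n) N L with hEdef
  have hle : ∀ n, ‖(pfkL2 v L t : Lp ℝ 2 (volume.restrict (cellN N L)) →L[ℝ] _)‖ ≤
      Real.exp (-((E n).toReal * t)) := fun n => by
    rw [hEdef, ← opNorm_pfkL2_truncPotential hv hN hL n ht]
    exact opNorm_pfkL2_anti_potential (hv.1.min measurable_const) hv.1 (fun r => min_le_left _ _) hL ht
  have hfin := periodicGroundStateEnergy_ne_top_of_integrable hv.1 hN hL hW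
  have hsup := iSup_periodicGroundStateEnergy_truncPotential hv.1 hN hL hW
  have htend : Tendsto (fun n => (E n).toReal) atTop (𝓝 (periodicGroundStateEnergy v N L).toReal) := by
    have h1 : Tendsto E atTop (𝓝 (⨆ n, E n)) :=
      tendsto_atTop_iSup (monotone_periodicGroundStateEnergy_truncPotential v N L)
    rw [hEdef] at h1 ⊢
    simp only at h1
    rw [hsup] at h1
    exact (ENNReal.tendsto_toReal hfin).comp h1
  have hcont : Tendsto (fun n => Real.exp (-((E n).toReal * t))) atTop
      (𝓝 (Real.exp (-((periodicGroundStateEnergy v N L).toReal * t)))) :=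
    (Real.continuous_exp.tendsto _).comp ((htend.mul_const t).neg)
  exact ge_of_tendsto' hcont hle

/-- **Registered sub-goal `stub_pfOpNorm` of the crux item** (S-B part 1, line `linear-ph-floor-wagner`, v11):
the operator norm bound `‖e^{-tH_v}‖ ≤ e^{-tE₀(v)}` (`opNorm_pfkL2_le_exp`). [cite: ReedSimonIV1978, Thm XIII.44] -/
theorem stub_pfOpNorm :
    ∀ {N : ℕ} {v : ℝ → ℝ≥0∞}, IsRepulsiveFiniteRange v → (∫⁻ x : Space, v ‖x‖) ≠ ⊤ → 1 ≤ N → ∀ {L : ℝ}, 0 < L → ∀ {t : ℝ}, 0 < t → ‖(pfkL2 v L t : Lp ℝ 2 (volume.restrict (cellN N L)) →L[ℝ] Lp ℝ 2 (volume.restrict (cellN N L)))‖ ≤ Real.exp (-((periodicGroundStateEnergy v N L).toReal * t)) :=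
  fun hv hint hN _ hL _ ht => opNorm_pfkL2_le_exp hv hint hN hL ht

end Summit.AtomisticToContinuum.BoseEinsteinCondensation.Cruxes.PeriodicIRBound.LinearPhFloorWagner

end
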